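import Literature.Probability.RandomPlanarGeometry.SAWBridgePatternRatio
import Literature.Probability.RandomPlanarGeometry.SAWHalfSpaceConcat
import Literature.Probability.RandomPlanarGeometry.HammersleyWelshSharp
import HarnessLib

/-!
# Kesten's inequality (7.3.4) for HALF-SPACE walks and `h_{N+2}/h_N → μ²` (Lawler–Schramm–Werner (A.2)),
# every `ℤ^{d+2}`, unconditionally

Topic `Literature/Probability/RandomPlanarGeometry`, on top of `SAWBridgePatternRatio.lean` (the printed proof of
Madras–Slade Theorem 7.3.2 for a GENERIC swap-closed family `W_N`: `Zd.thm732W_of_bounds`; the bridge case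
`Zd.bridges_pattern_inputs`, `Zd.MadrasSlade1993_thm732b`, (7.3.13) `Zd.MadrasSlade1993_eq7313`),
`SAWHalfSpaceConcat.lean` (`Zd.bridgeCount_mul_halfSpaceCount_le : b_m h_n ≤ h_{m+n}`), `SAWRatioLimit.lean`
(Lemma 7.3.1 `Zd.tendsto_ratio_of_kesten`) and `HammersleyWelshSharp.lean`
(`Zd.halfSpaceCount_le_exp_sharp_mul_bridgeCount : h_n ≤ e^{π√(n/3)} b_n`).

Sources. N. Madras, G. Slade (1993), Theorem 7.3.2 (book p. 244): "(7.3.4) `φ_N φ_{N+2} ≥ φ_N² − D/N` … where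
`φ_N` is defined according to any one of the following: (a) `c_{N+2}/c_N` …; (b) `b_{N+2}/b_N` …; (c) …" — the
half-space family `h_N` is NOT among the printed cases; G. F. Lawler, O. Schramm, W. Werner (2004), Appendix, eq.
(A.2) (arXiv:math/0204277 p. 18, L45–50): "Kesten also proved that `lim υ_{n+2}/υ_n = β²` (see e.g. the proof of
[MS])", `υ_n = h_n`, qualitative. What is proved here (lane pcv-sawmu, planner route R27, items R27.1–R27.2): the
printed proof of Theorem 7.3.2 runs VERBATIM for `W_N = H_N` (the `(U,Q) ↔ (V,Q)` cube swap keeps half-space walks: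
an occurrence is never at step `0` and the swapped sites have first coordinates `≥ ω₁(k) > 0`), with the two
pattern-theorem inputs transported from bridges to half-space walks through `b_N ≤ h_N ≤ e^{π√(N/3)} b_N`; then
Lemma 7.3.1 with `h_N^{1/N} → μ` (sandwich `b_N ≤ h_N ≤ c_N`) and `h_{N+2} ≥ h_N` gives (A.2).

## Contents (namespace `Literature.Probability.RandomPlanarGeometry.SAW.Zd`), all PROVED, no definitions
* `occU_pos_of_isHalfSpace`, `occV_pos_of_isHalfSpace`, `insV_isHalfSpace`, `delV_isHalfSpace`,
  `insV_mem_halfSpaceWalks`, `delV_mem_halfSpaceWalks` — "`W_N = H_N` is swap-closed";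
* `halfSpace_pattern_inputs` — the `Ξ_N` and `S_N` inputs of `Zd.thm732W_of_bounds` for `W = H`;
* **`MadrasSlade1993_thm732_halfSpace`** — `∃ D, ∀ᶠ N, φ_N² − D/N ≤ φ_N φ_{N+2}`, `φ_N = h_{N+2}/h_N`;
* `tendsto_halfSpaceCount_rpow` — `h_N^{1/N} → μ`;
* **`LawlerSchrammWerner2004_eqA2`** — `h_{N+2}/h_N → μ²` on `ℤ^{d+2}`.
-/

noncomputable section

open Filter Topology Finset Literature.Probability.LatticeModels Literature.Probability.Percolation SimpleGraph
open scoped BigOperators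

namespace Literature.Probability.RandomPlanarGeometry.SAW.Zd

variable {d : ℕ}

/-! ### Half-space walks are swap-closed -/

/-- On a half-space walk, `(U,Q)` never occurs at step `0` (the point `u(1)` lies in the hyperplane `x₁ = 0`).
[cite: MadrasSlade1993, Theorem 7.3.2 (proof; the family `W_N`)] -/
theorem occU_pos_of_isHalfSpace {n k : ℕ} {ω : ℕ → Site (d + 2)} (hh : IsHalfSpace n ω)
    (hk : OccU n ω k) : 1 ≤ k := by
  by_contra h0
  have hk0 : k = 0 := by omega
  subst hk0
  obtain ⟨hkn, hseg, -⟩ := hk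
  have h1 := hseg 1 (by norm_num)
  have := hh 1 le_rfl (by omega)
  rw [zero_add] at h1
  rw [h1, Pi.add_apply, uPt_apply_zero] at this
  simp [uCoord] at this

/-- On a half-space walk, `(V,Q)` never occurs at step `0`. [cite: MadrasSlade1993, Theorem 7.3.2 (proof; the family `W_N`)] -/
theorem occV_pos_of_isHalfSpace {n k : ℕ} {ω : ℕ → Site (d + 2)} (hh : IsHalfSpace n ω)
    (hk : OccV n ω k) : 1 ≤ k := by
  by_contra h0
  have hk0 : k = 0 := by omega
  subst hk0
  obtain ⟨hkn, hseg, -⟩ := hk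
  have h1 := hseg 1 (by norm_num)
  have := hh 1 le_rfl (by omega)
  rw [zero_add] at h1
  rw [h1, Pi.add_apply, vPt_apply_zero] at this
  simp [vCoord] at this

/-- **Changing `(U,Q)` into `(V,Q)` on a half-space walk gives a half-space walk**: the new sites have first
coordinates `≥ ω₁(k) > ω₁(0)`. [cite: MadrasSlade1993, Theorem 7.3.2 (proof; the family `W_N`)] -/
theorem insV_isHalfSpace {n k : ℕ} {ω : ℕ → Site (d + 2)} (hh : IsHalfSpace n ω) (hk : OccU n ω k) :
    IsHalfSpace (n + 2) (insV k ω) := by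
  have hk1 := occU_pos_of_isHalfSpace hh hk
  obtain ⟨hkn, hseg, -⟩ := hk
  have h0 : insV k ω 0 = ω 0 := insV_apply_of_le _ _ (Nat.zero_le _)
  have hkb := hh k hk1 (by omega)
  intro i hi1 hi2
  rw [h0]
  rcases Nat.lt_or_ge k i with hki | hik
  · rcases Nat.lt_or_ge (k + 11) i with hbig | hwin
    · rw [insV_apply_of_gt _ _ hbig]
      exact hh (i - 2) (by omega) (by omega)
    · obtain ⟨s, rfl⟩ : ∃ s, i = k + s := ⟨i - k, by omega⟩
      rw [insV_apply_window _ _ (by omega), Pi.add_apply, vPt_apply_zero]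
      have := vCoord_fst_mem s
      linarith [this.1]
  · rw [insV_apply_of_le _ _ hik]
    exact hh i hi1 (by omega)

/-- **Changing `(V,Q)` back into `(U,Q)` on a half-space walk gives a half-space walk.**
[cite: MadrasSlade1993, Theorem 7.3.2 (proof; the family `W_N`)] -/
theorem delV_isHalfSpace {n k : ℕ} {ω : ℕ → Site (d + 2)} (hh : IsHalfSpace (n + 2) ω)
    (hk : OccV (n + 2) ω k) : IsHalfSpace n (delV k ω) := by
  have hk1 := occV_pos_of_isHalfSpace hh hk
  obtain ⟨hkn, hseg, -⟩ := hk
  have h0 : delV k ω 0 = ω 0 := delV_apply_of_le _ _ (Nat.zero_le _)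
  have hkb := hh k hk1 (by omega)
  intro i hi1 hi2
  rw [h0]
  rcases Nat.lt_or_ge k i with hki | hik
  · rcases Nat.lt_or_ge (k + 9) i with hbig | hwin
    · rw [delV_apply_of_gt _ _ hbig]
      exact hh (i + 2) (by omega) (by omega)
    · obtain ⟨s, rfl⟩ : ∃ s, i = k + s := ⟨i - k, by omega⟩
      rw [delV_apply_window _ _ (by omega), Pi.add_apply, uPt_apply_zero]
      have := uCoord_fst_mem s
      linarith [this.1]
  · rw [delV_apply_of_le _ _ hik]
    exact hh i hi1 (by omega)

/-- **"Let `W_N` be the set of half-space walks in `S_N`"**: swapping `(U,Q) → (V,Q)` keeps half-space walks.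
[cite: MadrasSlade1993, Theorem 7.3.2 (proof; the family `W_N`)] -/
theorem insV_mem_halfSpaceWalks {n k : ℕ} {ω : ℕ → Site (d + 2)} (hω : ω ∈ halfSpaceWalks (d + 2) n)
    (hk : OccU n ω k) : insV k ω ∈ halfSpaceWalks (d + 2) (n + 2) := by
  obtain ⟨hs, hh⟩ := mem_halfSpaceWalks.1 hω
  exact mem_halfSpaceWalks.2 ⟨insV_mem_saws hs hk, insV_isHalfSpace hh hk⟩

/-- … and swapping back `(V,Q) → (U,Q)` keeps half-space walks. [cite: MadrasSlade1993, Theorem 7.3.2 (proof; the family `W_N`)] -/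
theorem delV_mem_halfSpaceWalks {n k : ℕ} {ω : ℕ → Site (d + 2)} (hω : ω ∈ halfSpaceWalks (d + 2) (n + 2))
    (hk : OccV (n + 2) ω k) : delV k ω ∈ halfSpaceWalks (d + 2) n := by
  obtain ⟨hs, hh⟩ := mem_halfSpaceWalks.1 hω
  exact mem_halfSpaceWalks.2 ⟨delV_mem_saws hs hk, delV_isHalfSpace hh hk⟩

/-! ### The pattern-theorem inputs for half-space walks -/

/-- **The two pattern-theorem inputs for half-space walks** (Theorem 7.2.3 for `(V,Q)`, `thm723`, and the
envelopes `e^{-c√N} μ^N ≤ b_N ≤ h_N ≤ e^{π√(N/3)} b_N ≤ e^{π√(N/3)} μ^N`): for some `a > 0`, `C`, `C'`: (Ξ) for all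
`n ≥ 1` at most `C h_n/n³` half-space walks have `J < a n`; (S) eventually
`3 h_{N+2} #{η ∈ H_{N+2} : J = 0}/h_N² ≤ C'/N`.
[cite: MadrasSlade1993, Theorem 7.3.2 (proof, eqs. (7.3.5), (7.3.11)–(7.3.12)); Proposition 3.1.5] -/
theorem halfSpace_pattern_inputs (d : ℕ) : ∃ a C C' : ℝ, 0 < a ∧
    (∀ n : ℕ, 1 ≤ n →
      ((((halfSpaceWalks (d + 2) n).filter fun ω => (vCount n ω : ℝ) < a * n).card : ℝ)) ≤
        C * halfSpaceCount (d + 2) n / (n : ℝ) ^ 3) ∧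
    (∀ᶠ N : ℕ in atTop,
      3 * (halfSpaceCount (d + 2) (N + 2) : ℝ) *
        (((halfSpaceWalks (d + 2) (N + 2)).filter fun ω => ¬ 1 ≤ vCount (N + 2) ω).card : ℝ) /
        (halfSpaceCount (d + 2) N : ℝ) ^ 2 ≤ C' / N) := by
  classical
  obtain ⟨q, hq, ε, hε, hε1, N₀, hN₀⟩ := thm723 d
  set μ := connectiveConstant (d + 2) with hμdef
  have hμ1 : 1 ≤ μ := one_le_connectiveConstant (d + 2)
  have hμ0 : 0 < μ := by linarith
  -- Hammersley–Welsh lower bound for bridges, with `c ≥ 0`, transported to `h_n ≥ b_n`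
  obtain ⟨c₀, hc₀⟩ := exp_mul_pow_le_bridgeCount (d := d + 2)
  set c := max c₀ 0 with hcdef
  have hc0 : 0 ≤ c := le_max_right _ _
  have hbh : ∀ n : ℕ, (bridgeCount (d + 2) n : ℝ) ≤ halfSpaceCount (d + 2) n := fun n => by
    exact_mod_cast Finset.card_le_card (bridges_subset_halfSpaceWalks (d := d + 2) n)
  have hHW : ∀ n : ℕ, Real.exp (-(c * Real.sqrt n)) * μ ^ n ≤ halfSpaceCount (d + 2) n := fun n => by
    refine le_trans ?_ ((hc₀ n).trans (hbh n))
    apply mul_le_mul_of_nonneg_right _ (by positivity)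
    apply Real.exp_le_exp.2
    have := Real.sqrt_nonneg (n : ℝ)
    nlinarith [le_max_left c₀ 0]
  have hhpos : ∀ n, (0 : ℝ) < halfSpaceCount (d + 2) n := fun n => by
    exact_mod_cast one_le_halfSpaceCount (d := d + 2) n
  -- exponential bound on the few-pattern half-space walks, `n ≥ N₀`
  have hexph : ∀ n, N₀ ≤ n →
      ((((halfSpaceWalks (d + 2) n).filter fun ω => vCount n ω ≤ n / q).card : ℝ)) ≤ ((1 - ε) * μ) ^ n := by
    intro n hn
    refine le_trans ?_ (hN₀ n hn)
    exact_mod_cast Finset.card_le_card (Finset.filter_subset_filter _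
      (fun ω hω => (mem_halfSpaceWalks.1 hω).1))
  -- `((1-ε)μ)^n ≤ (1-ε)^n e^{c√n} h_n`
  have hkey : ∀ n : ℕ, ((1 - ε) * μ) ^ n ≤
      (1 - ε) ^ n * Real.exp (c * Real.sqrt n) * halfSpaceCount (d + 2) n := by
    intro n
    rw [mul_pow]
    have h1 : μ ^ n ≤ Real.exp (c * Real.sqrt n) * halfSpaceCount (d + 2) n := by
      have := hHW n
      rw [Real.exp_neg, inv_mul_le_iff₀ (Real.exp_pos _)] at this
      exact this
    calc (1 - ε) ^ n * μ ^ n ≤ (1 - ε) ^ n * (Real.exp (c * Real.sqrt n) * halfSpaceCount (d + 2) n) :=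
          mul_le_mul_of_nonneg_left h1 (pow_nonneg (by linarith) _)
      _ = _ := by ring
  -- decay constants
  obtain ⟨D₁, hD₁⟩ := decay_bound (r := 1 - ε) (by linarith) (by linarith) c 3
  obtain ⟨D₂, hD₂⟩ := decay_bound (r := 1 - ε) (by linarith) (by linarith) (2 * c + Real.pi) 1
  have hD₁0 : 0 ≤ D₁ := le_trans (by positivity) (hD₁ 0)
  refine ⟨1 / (2 * q), max D₁ ((N₀ : ℝ) ^ 3), 3 * μ ^ 4 * (1 - ε) ^ 2 * D₂, by positivity, ?_, ?_⟩
  · -- (Ξ): the polynomial pattern bound relative to `h_n`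
    intro n hn
    have hn0 : (0 : ℝ) < n := by exact_mod_cast hn
    have hsub := Finset.card_le_card (filter_vCount_lt_subset (d := d) hq (halfSpaceWalks (d + 2) n) n)
    have hb := hhpos n
    rcases le_or_gt N₀ n with hbig | hsmall
    · calc ((((halfSpaceWalks (d + 2) n).filter fun ω => (vCount n ω : ℝ) < 1 / (2 * q) * n).card : ℝ))
          ≤ (((halfSpaceWalks (d + 2) n).filter fun ω => vCount n ω ≤ n / q).card : ℝ) := by
            exact_mod_cast hsub
        _ ≤ ((1 - ε) * μ) ^ n := hexph n hbig
        _ ≤ (1 - ε) ^ n * Real.exp (c * Real.sqrt n) * halfSpaceCount (d + 2) n := hkey n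
        _ = ((1 - ε) ^ n * (n : ℝ) ^ 3 * Real.exp (c * Real.sqrt n)) * halfSpaceCount (d + 2) n /
              (n : ℝ) ^ 3 := by
            field_simp
        _ ≤ D₁ * halfSpaceCount (d + 2) n / (n : ℝ) ^ 3 := by
            apply div_le_div_of_nonneg_right _ (by positivity)
            exact mul_le_mul_of_nonneg_right (hD₁ n) hb.le
        _ ≤ max D₁ ((N₀ : ℝ) ^ 3) * halfSpaceCount (d + 2) n / (n : ℝ) ^ 3 := by
            apply div_le_div_of_nonneg_right _ (by positivity)
            exact mul_le_mul_of_nonneg_right (le_max_left _ _) hb.le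
    · -- small `n`: trivial bound `≤ h_n ≤ N₀³ h_n / n³`
      have h1 : ((((halfSpaceWalks (d + 2) n).filter fun ω => (vCount n ω : ℝ) < 1 / (2 * q) * n).card : ℝ))
          ≤ halfSpaceCount (d + 2) n := by
        exact_mod_cast Finset.card_filter_le _ _
      have h2 : (halfSpaceCount (d + 2) n : ℝ) ≤ (N₀ : ℝ) ^ 3 * halfSpaceCount (d + 2) n / (n : ℝ) ^ 3 := by
        rw [le_div_iff₀ (by positivity)]
        have : (n : ℝ) ^ 3 ≤ (N₀ : ℝ) ^ 3 := pow_le_pow_left₀ hn0.le (by exact_mod_cast hsmall.le) 3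
        nlinarith
      have h3 : (N₀ : ℝ) ^ 3 * halfSpaceCount (d + 2) n / (n : ℝ) ^ 3 ≤
          max D₁ ((N₀ : ℝ) ^ 3) * halfSpaceCount (d + 2) n / (n : ℝ) ^ 3 := by
        apply div_le_div_of_nonneg_right _ (by positivity)
        exact mul_le_mul_of_nonneg_right (le_max_right _ _) hb.le
      linarith
  · -- (S): `3 h_{N+2} Z_{N+2} / h_N² ≤ 3 μ⁴ (1-ε)^{N+2} e^{(2c+π)√N} ≤ C'/N`
    filter_upwards [eventually_ge_atTop (max N₀ 1)] with N hN
    have hN0 : N₀ ≤ N := le_trans (le_max_left _ _) hN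
    have hN1 : 1 ≤ N := le_trans (le_max_right _ _) hN
    have hNpos : (0 : ℝ) < N := by exact_mod_cast hN1
    have hNr1 : (1 : ℝ) ≤ N := by exact_mod_cast hN1
    -- `Z_{N+2} ≤ ((1-ε)μ)^{N+2}`
    have hZ : (((halfSpaceWalks (d + 2) (N + 2)).filter fun ω => ¬ 1 ≤ vCount (N + 2) ω).card : ℝ) ≤
        ((1 - ε) * μ) ^ (N + 2) := by
      refine le_trans ?_ (hexph (N + 2) (by omega))
      refine Nat.cast_le.2 (Finset.card_le_card fun ω => ?_)
      simp only [Finset.mem_filter, not_le, Nat.lt_one_iff]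
      rintro ⟨hω, hv⟩
      exact ⟨hω, by rw [hv]; exact Nat.zero_le _⟩
    -- `h_{N+2} ≤ e^{π√((N+2)/3)} b_{N+2} ≤ e^{π√N} μ^{N+2}`, `h_N ≥ e^{-c√N} μ^N`
    have hF : Real.exp (Real.pi * Real.sqrt (((N + 2 : ℕ) : ℝ) / 3)) ≤ Real.exp (Real.pi * Real.sqrt N) := by
      refine Real.exp_le_exp.2 (mul_le_mul_of_nonneg_left (Real.sqrt_le_sqrt ?_) Real.pi_pos.le)
      push_cast; linarith
    have hb2 : (halfSpaceCount (d + 2) (N + 2) : ℝ) ≤ Real.exp (Real.pi * Real.sqrt N) * μ ^ (N + 2) := by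
      have h1 := halfSpaceCount_le_exp_sharp_mul_bridgeCount (d := d + 2) (N + 2)
      have h2 : (bridgeCount (d + 2) (N + 2) : ℝ) ≤ μ ^ (N + 2) := bridgeCount_le_pow (N + 2)
      calc (halfSpaceCount (d + 2) (N + 2) : ℝ)
          ≤ Real.exp (Real.pi * Real.sqrt (((N + 2 : ℕ) : ℝ) / 3)) * bridgeCount (d + 2) (N + 2) := by
            simpa using h1
        _ ≤ Real.exp (Real.pi * Real.sqrt N) * μ ^ (N + 2) := mul_le_mul hF h2 (Nat.cast_nonneg _) (by positivity)
    have hbN := hHW N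
    have hbNpos := hhpos N
    have step1 : 3 * (halfSpaceCount (d + 2) (N + 2) : ℝ) *
        (((halfSpaceWalks (d + 2) (N + 2)).filter fun ω => ¬ 1 ≤ vCount (N + 2) ω).card : ℝ) ≤
        3 * (Real.exp (Real.pi * Real.sqrt N) * μ ^ (N + 2)) * ((1 - ε) * μ) ^ (N + 2) :=
      mul_le_mul (mul_le_mul_of_nonneg_left hb2 (by norm_num)) hZ (Nat.cast_nonneg _) (by positivity)
    have step2 : (Real.exp (-(c * Real.sqrt N)) * μ ^ N) ^ 2 ≤ (halfSpaceCount (d + 2) N : ℝ) ^ 2 :=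
      pow_le_pow_left₀ (by positivity) hbN 2
    have hden : 0 < (Real.exp (-(c * Real.sqrt N)) * μ ^ N) ^ 2 := by positivity
    have hexp1 : Real.exp ((2 * c + Real.pi) * Real.sqrt N) * Real.exp (-(c * Real.sqrt N)) ^ 2 =
        Real.exp (Real.pi * Real.sqrt N) := by
      rw [← Real.exp_nat_mul, ← Real.exp_add]
      congr 1; push_cast; ring
    have E : 3 * (Real.exp (Real.pi * Real.sqrt N) * μ ^ (N + 2)) * ((1 - ε) * μ) ^ (N + 2) =
        3 * μ ^ 4 * (1 - ε) ^ 2 * ((1 - ε) ^ N * Real.exp ((2 * c + Real.pi) * Real.sqrt N)) *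
          (Real.exp (-(c * Real.sqrt N)) * μ ^ N) ^ 2 := by
      calc 3 * (Real.exp (Real.pi * Real.sqrt N) * μ ^ (N + 2)) * ((1 - ε) * μ) ^ (N + 2)
          = 3 * μ ^ 4 * (1 - ε) ^ 2 * (1 - ε) ^ N * (μ ^ N) ^ 2 * Real.exp (Real.pi * Real.sqrt N) := by
            rw [mul_pow]; ring
        _ = 3 * μ ^ 4 * (1 - ε) ^ 2 * (1 - ε) ^ N * (μ ^ N) ^ 2 *
              (Real.exp ((2 * c + Real.pi) * Real.sqrt N) * Real.exp (-(c * Real.sqrt N)) ^ 2) := by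
            rw [hexp1]
        _ = _ := by ring
    calc 3 * (halfSpaceCount (d + 2) (N + 2) : ℝ) *
          (((halfSpaceWalks (d + 2) (N + 2)).filter fun ω => ¬ 1 ≤ vCount (N + 2) ω).card : ℝ) /
          (halfSpaceCount (d + 2) N : ℝ) ^ 2
        ≤ 3 * (Real.exp (Real.pi * Real.sqrt N) * μ ^ (N + 2)) * ((1 - ε) * μ) ^ (N + 2) /
            (Real.exp (-(c * Real.sqrt N)) * μ ^ N) ^ 2 :=
          div_le_div₀ (by positivity) step1 hden step2
      _ = 3 * μ ^ 4 * (1 - ε) ^ 2 * ((1 - ε) ^ N * Real.exp ((2 * c + Real.pi) * Real.sqrt N)) := by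
          rw [div_eq_iff hden.ne', ← E]
      _ ≤ 3 * μ ^ 4 * (1 - ε) ^ 2 * (D₂ / N) := by
          apply mul_le_mul_of_nonneg_left _ (by positivity)
          rw [le_div_iff₀ hNpos]
          have := hD₂ N
          rw [pow_one] at this
          nlinarith [this]
      _ = 3 * μ ^ 4 * (1 - ε) ^ 2 * D₂ / N := by ring

/-! ### Theorem 7.3.2 for half-space walks and (A.2) -/

/-- **Kesten's inequality (7.3.4) for half-space walks** on `ℤ^{d+2}`: there is `D` with
`φ_N² − D/N ≤ φ_N φ_{N+2}` for all large `N`, `φ_N = h_{N+2}/h_N` (the printed proof of Theorem 7.3.2 with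
`W_N = H_N`). [cite: MadrasSlade1993, Theorem 7.3.2 (book p. 244) and its proof (pp. 244–247); LawlerSchrammWerner2004SAW, Appendix, eq. (A.2)] -/
theorem MadrasSlade1993_thm732_halfSpace (d : ℕ) : ∃ D : ℝ, ∀ᶠ N : ℕ in atTop,
    ((halfSpaceCount (d + 2) (N + 2) : ℝ) / halfSpaceCount (d + 2) N) ^ 2 - D / N ≤
      ((halfSpaceCount (d + 2) (N + 2) : ℝ) / halfSpaceCount (d + 2) N) *
        ((halfSpaceCount (d + 2) (N + 4) : ℝ) / halfSpaceCount (d + 2) (N + 2)) := by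
  obtain ⟨a, C, C', ha, hPT, hS⟩ := halfSpace_pattern_inputs d
  have hpos : ∀ n, 0 < (halfSpaceWalks (d + 2) n).card := fun n => one_le_halfSpaceCount (d := d + 2) n
  have h := thm732W_of_bounds (W := fun n => halfSpaceWalks (d + 2) n)
    (fun hω hk => insV_mem_halfSpaceWalks hω hk) (fun hω hk => delV_mem_halfSpaceWalks hω hk) hpos ha hPT hS
  exact ⟨_, h⟩

/-- `h_n ≤ h_{n+2}` (prepend the bridge `(0, e₁, 2e₁)`). [cite: LawlerSchrammWerner2004SAW, Appendix] -/
theorem halfSpaceCount_le_add_two {d' : ℕ} [NeZero d'] (n : ℕ) :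
    halfSpaceCount d' n ≤ halfSpaceCount d' (n + 2) := by
  rw [add_comm]; exact halfSpaceCount_le_add_left 2 n

/-- **`h_N^{1/N} → μ`** (sandwich `b_N ≤ h_N ≤ c_N`, both roots tend to `μ`).
[cite: MadrasSlade1993, Corollary 3.1.6, eq. (3.1.10); LawlerSchrammWerner2004SAW, Appendix] -/
theorem tendsto_halfSpaceCount_rpow {d' : ℕ} [NeZero d'] :
    Tendsto (fun n : ℕ => (halfSpaceCount d' n : ℝ) ^ (1 / (n : ℝ))) atTop (𝓝 (connectiveConstant d')) := by
  refine tendsto_of_tendsto_of_tendsto_of_le_of_le tendsto_bridgeCount_rpow (tendsto_count_rpow d')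
    (fun n => ?_) (fun n => ?_)
  · exact Real.rpow_le_rpow (Nat.cast_nonneg _)
      (by exact_mod_cast Finset.card_le_card (bridges_subset_halfSpaceWalks (d := d') n)) (by positivity)
  · exact Real.rpow_le_rpow (Nat.cast_nonneg _) (by exact_mod_cast halfSpaceCount_le_count (d := d') n)
      (by positivity)

/-- **Lawler–Schramm–Werner (A.2): `h_{N+2}/h_N → μ²`** on `ℤ^{d+2}` — Lemma 7.3.1 with `a_N = h_N`: (i)
`h_N^{1/N} → μ`, (ii) `h_{N+2}/h_N ≥ 1`, (iii) Theorem 7.3.2 for half-space walks ("Kesten also proved that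
`lim υ_{n+2}/υ_n = β²`"). [cite: LawlerSchrammWerner2004SAW, Appendix, eq. (A.2); MadrasSlade1993, Lemma 7.3.1 and Theorem 7.3.2] -/
theorem LawlerSchrammWerner2004_eqA2 (d : ℕ) :
    Tendsto (fun N : ℕ => (halfSpaceCount (d + 2) (N + 2) : ℝ) / halfSpaceCount (d + 2) N) atTop
      (𝓝 (connectiveConstant (d + 2) ^ 2)) := by
  have hhpos : ∀ n, (0 : ℝ) < halfSpaceCount (d + 2) n := fun n =>
    Nat.cast_pos.2 (Nat.lt_of_lt_of_le Nat.zero_lt_one (one_le_halfSpaceCount (d := d + 2) n))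
  have hii : ∃ c : ℝ, 0 < c ∧ ∀ᶠ n : ℕ in atTop,
      c ≤ (halfSpaceCount (d + 2) (n + 2) : ℝ) / halfSpaceCount (d + 2) n := by
    refine ⟨1, one_pos, Eventually.of_forall fun n => ?_⟩
    rw [le_div_iff₀ (hhpos n), one_mul]
    exact_mod_cast halfSpaceCount_le_add_two (d' := d + 2) n
  have h732 := MadrasSlade1993_thm732_halfSpace d
  exact tendsto_ratio_of_kesten (a := fun n => (halfSpaceCount (d + 2) n : ℝ))
    (connectiveConstant_pos (d + 2)) hhpos tendsto_halfSpaceCount_rpow hii h732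

end Literature.Probability.RandomPlanarGeometry.SAW.Zd

end
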